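import Summits.HodgeConjecture.HodgeConjecture.Theorems.F0P3StubE2pFold                -- ★ (p03 g3 ∕ p01 g4): `hodgeTypeRigid_of_cohArchComponentRigid_cpt`'s inputs (value-map heads, J2, S2, F1a-at-the-pin API)
import Summits.HodgeConjecture.HodgeConjecture.Theorems.F0P3StubF1aHolHalf              -- ★ p805224 (p02 g3): `archIsotypy_of_isHolCotangentAt` — F1a IN-HOUSE for hol-type `P`
import Summits.HodgeConjecture.HodgeConjecture.Theorems.F0P3ArchIsotypyConj             -- ★ p803493 (p01 g4): `archIsotypy_cm_of_hol_half` — conjugation transport hol → antihol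
import HarnessLib

/-!
# Crux `H413` — RUNG 3 under CONTRACT v6: the two S-LAYER FOLDS as GENERIC, POINTWISE tree theorems (packet vocabulary BOUND),
# and the cohomology-TOKEN PRODUCERS they run on

Floor-0 programme P3 «U3-mult», seat F0P3-p03 (g5); crux item stmt-HodgeConjecture-24833 (`HCCMUnconditional.H413`); rung-1 line
`Cruxes/H413/Lines/F0_U3LettersRung1.lean` ed. 2.6 (open stubs `stub_E1 : StubE1coh`, `stub_beta`; CONTRACT v6 = F0P3-plan (g3) RULING (K)
2026-08-31T04:44Z: β shrinks to its consumed instance `StubBetaOpp`), commission K4 = RULING (L1) 04:48Z.  PROOF lane: no `def`, no `sorry`, no named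
fact asserted; `--supports stmt-HodgeConjecture-24833`.  HONEST LABEL: HC_CM is proved only modulo the printed citations until rung 0 closes; this
file discharges none of them — it fixes the SHAPES through which the S-layer facts of [Rogawski1990] Ch. 13–14 will be consumed.

THE POINT.  Both open stubs factor through ONE packet vocabulary (PLAN.F0P3g3 §15: D5 `OneDimAutRepH` = one-dimensional automorphic
representations `ξ` of the endoscopic `H = U(2) × U(1)`, D6 `MemAPacket P ξ` = «`P ∈ Π′(ξ)`») and four facts (S2♭ «`H¹`-cohomological discrete `P` lie in
an A-packet» [Thm. 13.3.6 (c) + §15.3 ¶1], S3♭ «a common finite component pins `ξ`» [Thm. 14.6.4 proof l. 1 + Thm. 13.3.5], the SIGN clause of D6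
«the archimedean type `δ` of a cohomological constituent of `P ∈ Π′(ξ)` is `sgn ξ`» [§12.3 p. 175 + Prop. 15.2.1], M♭ «`m(P) ≤ 1` on `Π′(ξ)`»
[Thm. 14.6.4]).  D5∕D6 are not tree vocabulary yet, so here the packet type is a BOUND variable `Ξ`, membership a BOUND predicate
`Mem : DiscreteAutomorphicRep 𝒢 μ → Ξ → Prop` and the sign a BOUND function `sgn : Ξ → ℤ`: the folds below are honest theorems `∀ Ξ Mem sgn`, pure
logic over the four hypothesis SHAPES, with conclusions = the bodies of `StubBetaOpp` ∕ `StubE1coh` after the datum binders `L ι H T hT hdef h2 μ`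
VERBATIM.  Edition 3 of the line instantiates `Ξ := OneDimAutRepH L`, `Mem := MemAPacket …`, `sgn := archSign ι` by `intro <datum>; exact …`.

CONTENTS (datum `L ι H T hT hdef h2 μ` fixed as section variables throughout):
* §1 TOKEN PRODUCERS (real content, reusable; extracted from ★ `F0P3StubE2pFold.hodgeTypeRigid_of_cohArchComponentRigid_cpt` :186–204):
  `exists_cohToken_of_isHolCotangentAt_cpt` — a discrete `P` of HOLOMORPHIC cotangent type at `ι` has an irreducible `(𝔤, K)`-module `M` of
  `U(2,1)_{Fin 2 ⊕ Fin 1}` receiving a NON-ZERO `(𝔤, K)`-map from `P.archModuleCM ι T hT` (β's three conjuncts) with a type-`(+1)` degree-one class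
  `upqTypeClasses σK σ𝔤 _ 1 1 ≠ ⊥`; `exists_cohToken_of_isAntiholCotangentAt_cpt` — the ANTIHOLOMORPHIC twin, type `(−1)`;
  `exists_cohToken_of_isHolOrAntihol_cpt` — the disjunction, with `δ ∈ {±1}`.  Ingredients, all ★: F1a in-house (`archIsotypy_of_isHolCotangentAt`,
  `archIsotypy_cm_of_hol_half`) → `exists_detecting_irreducible`; B1′ heads `hVal_hol` ∕ `hVal_antihol`; S2 `valueMap_comp`; J2
  `typeClasses_ne_bot_of_linearMap`.
* §2 `betaOpp_pointwise_of_SLayer (Mem) (sgn) (hS2) (hSgn) (hS3) : <StubBetaOpp body>` — `1 = sgn ξ`, `−1 = sgn ξ′`, `ξ = ξ′`: absurd.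
* §3 `e1coh_pointwise_of_SLayer (Mem) (hS2) (hMult) : <StubE1coh body>` — §1 token ⇒ `ξ` with `Mem P ξ` (hS2) ⇒ `m(P) ≤ 1` (hMult).
The hypothesis shapes `hS2` ∕ `hSgn` ∕ `hS3` ∕ `hMult` are the typer's signatures for S2♭ ∕ D6-sign ∕ S3♭ ∕ M♭ (PLAN §16).

References: [Rogawski1990] J. Rogawski, Ann. of Math. Stud. 123 (1990), Thm. 13.3.5, Thm. 13.3.6 (c), §14.6 Thm. 14.6.4, §12.3 p. 175, Prop. 15.2.1,
§15.3 ¶1; [BorelWallach2000] VI Thm. 4.11, II §4.2; [FlathCorvallis1979] Thm. 3–4.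
-/

-- Mathlib idiom (as in ★ `GKModules`, ★ `F0P3StubE2pFold`): commutator bracket on `Module.End ℂ V`
attribute [local instance 100] LieRing.ofAssociativeRing

set_option autoImplicit false
set_option linter.dupNamespace false

noncomputable section

namespace Summit.HodgeConjecture.HodgeConjecture.Cruxes.H413.F0P3SLayerFoldShapes

open NumberField NumberField.InfinitePlace MeasureTheory
open scoped Matrix MatrixGroups ComplexOrder
open Literature.RepresentationTheory.BorelWallach2000
open Literature.NumberTheory.Automorphic Literature.NumberTheory.Automorphic.UnitaryGroup
open Literature.NumberTheory.Automorphic.UnitaryGroup.CotangentForms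
open Literature.RepresentationTheory.KonnoKonno2007 Literature.RepresentationTheory.KonnoKonno2007.RealDualPair
open Literature.RepresentationTheory.KonnoKonno2007.RealDualPair.UForm
open Summit.HodgeConjecture.HodgeConjecture.Cruxes.H413.F0P3HodgeTypeRigidOfArchRigid
open Summit.HodgeConjecture.HodgeConjecture.Cruxes.H413.F0P3ValueMapHeads
open Summit.HodgeConjecture.HodgeConjecture.Cruxes.H413.F0P3ArchIsotypyCM
open Summit.HodgeConjecture.HodgeConjecture.Cruxes.H413.F0P3ValueMapTransport
open Summit.HodgeConjecture.HodgeConjecture.Cruxes.H413.F0P3PNullMapIsCocycle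
open Summit.HodgeConjecture.HodgeConjecture.Cruxes.H413.F0P3bArchDegOnePackage
open Summit.HodgeConjecture.HodgeConjecture.Cruxes.H413.F0P3StubF1aHolHalf
open Summit.HodgeConjecture.HodgeConjecture.Cruxes.H413.F0P3ArchIsotypyConj

section Datum

/-! Throughout: ONE compact-quotient CM datum — `L` CM with `[L⁺:ℚ] ≥ 2`, `ι : L →+* ℂ`, `H ∈ M₃(L)` hermitian with a frame `T` at `ι`
(signature `(2,1)`), positive definite at the complex places `≠` that of `ι`, and an automorphic measure `μ` on `U(H)(L⁺)\U(H)(𝔸_{L⁺})`. -/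
variable (L : Type) [Field L] [NumberField L] [IsCMField L] (ι : L →+* ℂ) (H : Matrix (Fin 3) (Fin 3) L) (T : GL (Fin 3) ℂ)
  (hT : (T : Matrix (Fin 3) (Fin 3) ℂ)ᴴ * H.map ι * (T : Matrix (Fin 3) (Fin 3) ℂ) = Literature.Geometry.ComplexHyperbolic.BallModel.J)
  (μ : Measure (adelicGroupData (↥(maximalRealSubfield L)) L (IsCMField.complexConj L) 3 H).automorphicQuotient)
  [(adelicGroupData (↥(maximalRealSubfield L)) L (IsCMField.complexConj L) 3 H).IsAutomorphicMeasure μ]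

/-! ## §1 Cohomology-token producers (the `(𝔤, K)`-currency of β ∕ β_opp ∕ S2♭, from the Hodge type of `P` at `ι`) -/

/-- **Holomorphic token.**  A discrete automorphic `P` of `U(H)` of HOLOMORPHIC cotangent type at `ι` has an IRREDUCIBLE `(𝔤, K)`-module
`(M, σK, σ𝔤)` of `U(2,1)_{Fin 2 ⊕ Fin 1}` receiving a NON-ZERO `(𝔤, K)`-map from its archimedean module `P.archModuleCM ι T hT` and carrying a
degree-one class of type `+1` (`upqTypeClasses σK σ𝔤 _ 1 1 ≠ ⊥`).  Proof = ★ `hodgeTypeRigid_of_cohArchComponentRigid_cpt`'s first half: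
F1a at the pin IN-HOUSE (★ `archIsotypy_of_isHolCotangentAt`) gives the detecting irreducible module (★ `exists_detecting_irreducible`), the
value map of the holomorphic form (★ `hVal_hol`) composed with a detecting map is a non-zero typed-`(+1)` value map on `M` (★ `valueMap_comp`),
hence a non-zero class (★ J2 `typeClasses_ne_bot_of_linearMap`). [cite: BorelWallach2000, VI Thm. 4.11; II §4.2] [cite: Rogawski1990, Prop. 15.2.1 (b)]
[cite: FlathCorvallis1979, Thm. 3] -/
theorem exists_cohToken_of_isHolCotangentAt_cpt
    (hdef : ∀ τ' : L →+* ℂ, InfinitePlace.mk τ' ≠ InfinitePlace.mk ι → (H.map τ').PosDef) (h2 : 2 ≤ Module.finrank ℚ ↥(maximalRealSubfield L))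
    (P : DiscreteAutomorphicRep (adelicGroupData (↥(maximalRealSubfield L)) L (IsCMField.complexConj L) 3 H) μ)
    (hP : P.IsHolCotangentAt (cmArchSection L ι H T hT) (cmCompactFactor L ι H T hT)) :
    ∃ (M : Type) (_ : AddCommGroup M) (_ : Module ℂ M) (σK : Representation ℂ (uFormGroup (Fin 2) (Fin 1)).maximalCompact M)
      (σ𝔤 : (uFormGroup (Fin 2) (Fin 1)).lie →ₗ⁅ℝ⁆ Module.End ℂ M) (hM : IsGKModule (uFormGroup (Fin 2) (Fin 1)) σK σ𝔤),
      IsIrreducibleGK σK σ𝔤 ∧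
        (∃ T₁ : P.archModuleCM ι T hT →ₗ[ℂ] M,
          (∀ (k : (uFormGroup (Fin 2) (Fin 1)).maximalCompact) (w : P.archModuleCM ι T hT),
              T₁ (P.archRepKCM ι T hT k w) = σK k (T₁ w)) ∧
            (∀ (X : (uFormGroup (Fin 2) (Fin 1)).lie) (w : P.archModuleCM ι T hT),
              T₁ (P.archRepLieCM ι T hT X w) = σ𝔤 X (T₁ w)) ∧ T₁ ≠ 0) ∧
        upqTypeClasses σK σ𝔤 hM.ad_compat 1 1 ≠ ⊥ := by
  -- letter F1a at the pin, IN-HOUSE for the hol-type `P`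
  have hIso := archIsotypy_of_isHolCotangentAt ι T hT hdef h2 μ P hP
  -- the holomorphic cotangent form and its value map (B1′)
  obtain ⟨Φ, hΦ, hΦ0, hcont⟩ := hP
  have hval := hVal_hol L ι H T hT hdef h2 μ P Φ hΦ hΦ0 hcont
  obtain ⟨φ, hφ0, h0, hK, h𝔨, hwt, hN⟩ := hval
  -- the detecting irreducible module (F1a unpacked at the pin) and a detecting map
  have hex := exists_detecting_irreducible ι T hT P hIso
  obtain ⟨M, i₁, i₂, σK, σ𝔤, hGK, hirrM, -, hdet⟩ := hex
  have hX := exists_apply_ne_zero_of_ne_zero hφ0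
  obtain ⟨X₀, hX₀⟩ := hX
  have hT1 := hdet _ hX₀
  obtain ⟨T₁, hT₁K, hT₁𝔤, hT₁⟩ := hT1
  have hT₁0 : T₁ ≠ 0 := fun h => hT₁ (h ▸ rfl)
  -- the typed value map on `M` and the cohomology class it gives
  have c1 : ((1 : ℤ) : ℂ) = 1 := Int.cast_one
  have hq := valueMap_comp (δ := 1) φ T₁ hT₁K hT₁𝔤 h0 hK h𝔨
    (fun X => eq_intCast_mul_I_smul_of_eq_one (V := ↥(P.archModuleCM ι T hT)) c1 (hwt X))
    (fun X s => add_intCast_mul_I_smul_eq_zero_of_eq_one (V := ↥(P.archModuleCM ι T hT)) c1 (hN X s))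
  obtain ⟨q0, qK, q𝔨, qwt, qN⟩ := hq
  have hne : upqTypeClasses σK σ𝔤 hGK.ad_compat 1 1 ≠ ⊥ :=
    typeClasses_ne_bot_of_linearMap σK σ𝔤 hGK.ad_compat hirrM (Or.inl rfl) _
      (comp_ne_zero_of_apply_ne_zero φ T₁ hT₁) q0 qK q𝔨 qwt qN
  exact ⟨M, i₁, i₂, σK, σ𝔤, hGK, hirrM, ⟨T₁, hT₁K, hT₁𝔤, hT₁0⟩, hne⟩

/-- **Antiholomorphic token.**  A discrete automorphic `P` of `U(H)` of ANTIHOLOMORPHIC cotangent type at `ι` has an irreducible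
`(𝔤, K)`-module receiving a non-zero `(𝔤, K)`-map from `P.archModuleCM ι T hT` and carrying a degree-one class of type `−1`.  F1a at the pin for
the antihol-type `P` is the in-house hol half transported along `P ↦ P̄` (★ `archIsotypy_cm_of_hol_half`); then as in the holomorphic case with
★ `hVal_antihol` and `δ := −1`. [cite: BorelWallach2000, VI Thm. 4.11; II §4.2] [cite: Rogawski1990, Prop. 15.2.1 (b)] [cite: FlathCorvallis1979, Thm. 3] -/
theorem exists_cohToken_of_isAntiholCotangentAt_cpt
    (hdef : ∀ τ' : L →+* ℂ, InfinitePlace.mk τ' ≠ InfinitePlace.mk ι → (H.map τ').PosDef) (h2 : 2 ≤ Module.finrank ℚ ↥(maximalRealSubfield L))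
    (P : DiscreteAutomorphicRep (adelicGroupData (↥(maximalRealSubfield L)) L (IsCMField.complexConj L) 3 H) μ)
    (hP : P.IsAntiholCotangentAt (cmArchSection L ι H T hT) (cmCompactFactor L ι H T hT)) :
    ∃ (M : Type) (_ : AddCommGroup M) (_ : Module ℂ M) (σK : Representation ℂ (uFormGroup (Fin 2) (Fin 1)).maximalCompact M)
      (σ𝔤 : (uFormGroup (Fin 2) (Fin 1)).lie →ₗ⁅ℝ⁆ Module.End ℂ M) (hM : IsGKModule (uFormGroup (Fin 2) (Fin 1)) σK σ𝔤),
      IsIrreducibleGK σK σ𝔤 ∧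
        (∃ T₁ : P.archModuleCM ι T hT →ₗ[ℂ] M,
          (∀ (k : (uFormGroup (Fin 2) (Fin 1)).maximalCompact) (w : P.archModuleCM ι T hT),
              T₁ (P.archRepKCM ι T hT k w) = σK k (T₁ w)) ∧
            (∀ (X : (uFormGroup (Fin 2) (Fin 1)).lie) (w : P.archModuleCM ι T hT),
              T₁ (P.archRepLieCM ι T hT X w) = σ𝔤 X (T₁ w)) ∧ T₁ ≠ 0) ∧
        upqTypeClasses σK σ𝔤 hM.ad_compat 1 (-1) ≠ ⊥ := by
  -- letter F1a at the pin for the antihol-type `P`: the in-house hol half transported along complex conjugation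
  have hIso : P.ArchIsotypy (uFormGroup (Fin 2) (Fin 1)) (cmArchSectionUForm L ι H T hT) :=
    archIsotypy_cm_of_hol_half L ι H T hT μ (fun P' hP' => archIsotypy_of_isHolCotangentAt ι T hT hdef h2 μ P' hP') P (Or.inr hP)
  -- the antiholomorphic cotangent form and its value map (B1′)
  obtain ⟨Ψ, hΨ, hΨ0, hcont⟩ := hP
  have hval := hVal_antihol L ι H T hT hdef h2 μ P Ψ hΨ hΨ0 hcont
  obtain ⟨φ, hφ0, h0, hK, h𝔨, hwt, hN⟩ := hval
  -- the detecting irreducible module and a detecting map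
  have hex := exists_detecting_irreducible ι T hT P hIso
  obtain ⟨M, i₁, i₂, σK, σ𝔤, hGK, hirrM, -, hdet⟩ := hex
  have hX := exists_apply_ne_zero_of_ne_zero hφ0
  obtain ⟨X₁, hX₁⟩ := hX
  have hT2 := hdet _ hX₁
  obtain ⟨T₂, hT₂K, hT₂𝔤, hT₂⟩ := hT2
  have hT₂0 : T₂ ≠ 0 := fun h => hT₂ (h ▸ rfl)
  -- the typed value map on `M` and the cohomology class it gives
  have c2 : ((-1 : ℤ) : ℂ) = -1 := by rw [Int.cast_neg, Int.cast_one]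
  have hr := valueMap_comp (δ := -1) φ T₂ hT₂K hT₂𝔤 h0 hK h𝔨
    (fun X => eq_intCast_mul_I_smul_of_eq_neg_one (V := ↥(P.archModuleCM ι T hT)) c2 (hwt X))
    (fun X s => add_intCast_mul_I_smul_eq_zero_of_eq_neg_one (V := ↥(P.archModuleCM ι T hT)) c2 (hN X s))
  obtain ⟨r0, rK, r𝔨, rwt, rN⟩ := hr
  have hne : upqTypeClasses σK σ𝔤 hGK.ad_compat 1 (-1) ≠ ⊥ :=
    typeClasses_ne_bot_of_linearMap σK σ𝔤 hGK.ad_compat hirrM (Or.inr rfl) _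
      (comp_ne_zero_of_apply_ne_zero φ T₂ hT₂) r0 rK r𝔨 rwt rN
  exact ⟨M, i₁, i₂, σK, σ𝔤, hGK, hirrM, ⟨T₂, hT₂K, hT₂𝔤, hT₂0⟩, hne⟩

/-- **Token of either type.**  A discrete `P` of holomorphic OR antiholomorphic cotangent type at `ι` (the hypothesis of `StubE1coh`) has an
irreducible `(𝔤, K)`-module receiving a non-zero `(𝔤, K)`-map from `P.archModuleCM ι T hT` with a degree-one class of SOME type `δ ∈ {±1}` —
exactly the antecedent block of the S2♭ shape `hS2` below. [cite: BorelWallach2000, VI Thm. 4.11] [cite: Rogawski1990, Prop. 15.2.1 (b)] -/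
theorem exists_cohToken_of_isHolOrAntihol_cpt
    (hdef : ∀ τ' : L →+* ℂ, InfinitePlace.mk τ' ≠ InfinitePlace.mk ι → (H.map τ').PosDef) (h2 : 2 ≤ Module.finrank ℚ ↥(maximalRealSubfield L))
    (P : DiscreteAutomorphicRep (adelicGroupData (↥(maximalRealSubfield L)) L (IsCMField.complexConj L) 3 H) μ)
    (hP : P.IsHolCotangentAt (cmArchSection L ι H T hT) (cmCompactFactor L ι H T hT) ∨
      P.IsAntiholCotangentAt (cmArchSection L ι H T hT) (cmCompactFactor L ι H T hT)) :
    ∃ (M : Type) (_ : AddCommGroup M) (_ : Module ℂ M) (σK : Representation ℂ (uFormGroup (Fin 2) (Fin 1)).maximalCompact M)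
      (σ𝔤 : (uFormGroup (Fin 2) (Fin 1)).lie →ₗ⁅ℝ⁆ Module.End ℂ M) (hM : IsGKModule (uFormGroup (Fin 2) (Fin 1)) σK σ𝔤) (δ : ℤ),
      (δ = 1 ∨ δ = -1) ∧ IsIrreducibleGK σK σ𝔤 ∧
        (∃ T₁ : P.archModuleCM ι T hT →ₗ[ℂ] M,
          (∀ (k : (uFormGroup (Fin 2) (Fin 1)).maximalCompact) (w : P.archModuleCM ι T hT),
              T₁ (P.archRepKCM ι T hT k w) = σK k (T₁ w)) ∧
            (∀ (X : (uFormGroup (Fin 2) (Fin 1)).lie) (w : P.archModuleCM ι T hT),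
              T₁ (P.archRepLieCM ι T hT X w) = σ𝔤 X (T₁ w)) ∧ T₁ ≠ 0) ∧
        upqTypeClasses σK σ𝔤 hM.ad_compat 1 δ ≠ ⊥ := by
  rcases hP with hP | hP
  · have h := exists_cohToken_of_isHolCotangentAt_cpt L ι H T hT μ hdef h2 P hP
    obtain ⟨M, i₁, i₂, σK, σ𝔤, hM, hirr, hT₁, hne⟩ := h
    exact ⟨M, i₁, i₂, σK, σ𝔤, hM, 1, Or.inl rfl, hirr, hT₁, hne⟩
  · have h := exists_cohToken_of_isAntiholCotangentAt_cpt L ι H T hT μ hdef h2 P hP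
    obtain ⟨M, i₁, i₂, σK, σ𝔤, hM, hirr, hT₁, hne⟩ := h
    exact ⟨M, i₁, i₂, σK, σ𝔤, hM, -1, Or.inr rfl, hirr, hT₁, hne⟩

/-! ## §2–§3 The two S-layer folds, POINTWISE in the datum, over a BOUND packet vocabulary `(Ξ, Mem, sgn)` -/

variable {Ξ : Type*}
  (Mem : DiscreteAutomorphicRep (adelicGroupData (↥(maximalRealSubfield L)) L (IsCMField.complexConj L) 3 H) μ → Ξ → Prop)
  (sgn : Ξ → ℤ)

/-- **β_opp ⇐ S2♭ + D6-sign + S3♭ (pointwise fold; pure logic).**  For ANY packet type `Ξ`, membership predicate `Mem` and sign `sgn`: if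
(hS2) every discrete `P` with an irreducible `(𝔤, K)`-module receiving a non-zero `(𝔤, K)`-map from `P.archModuleCM ι T hT` and carrying a
degree-one class of type `δ ∈ {±1}` lies in some packet `ξ` [Rogawski1990 Thm. 13.3.6 (c), §15.3 ¶1], (hSgn) the type `δ` of any such module of a
member `P` of `Π′(ξ)` equals `sgn ξ` [§12.3 p. 175, Prop. 15.2.1], and (hS3) two members with a common irreducible smooth finite component `σ`
have the same `ξ` [Thm. 14.6.4 proof l. 1, Thm. 13.3.5], then the body of `StubBetaOpp` at this datum holds: a type-`(+1)` detected module for `P`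
and a type-`(−1)` one for `P′` over a common `σ` give `1 = sgn ξ = sgn ξ′ = −1`. [cite: Rogawski1990, Thm. 13.3.6 (c); Thm. 13.3.5; §14.6 Thm. 14.6.4;
§12.3 p. 175; Prop. 15.2.1; §15.3 ¶1] -/
theorem betaOpp_pointwise_of_SLayer
    (hS2 : ∀ (P : DiscreteAutomorphicRep (adelicGroupData (↥(maximalRealSubfield L)) L (IsCMField.complexConj L) 3 H) μ)
      (M : Type) [AddCommGroup M] [Module ℂ M] (σK : Representation ℂ (uFormGroup (Fin 2) (Fin 1)).maximalCompact M)
      (σ𝔤 : (uFormGroup (Fin 2) (Fin 1)).lie →ₗ⁅ℝ⁆ Module.End ℂ M) (hM : IsGKModule (uFormGroup (Fin 2) (Fin 1)) σK σ𝔤),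
      IsIrreducibleGK σK σ𝔤 →
      (∃ T₁ : P.archModuleCM ι T hT →ₗ[ℂ] M,
        (∀ (k : (uFormGroup (Fin 2) (Fin 1)).maximalCompact) (w : P.archModuleCM ι T hT),
            T₁ (P.archRepKCM ι T hT k w) = σK k (T₁ w)) ∧
          (∀ (X : (uFormGroup (Fin 2) (Fin 1)).lie) (w : P.archModuleCM ι T hT),
            T₁ (P.archRepLieCM ι T hT X w) = σ𝔤 X (T₁ w)) ∧ T₁ ≠ 0) →
      ∀ δ : ℤ, (δ = 1 ∨ δ = -1) → upqTypeClasses σK σ𝔤 hM.ad_compat 1 δ ≠ ⊥ → ∃ ξ : Ξ, Mem P ξ)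
    (hSgn : ∀ (P : DiscreteAutomorphicRep (adelicGroupData (↥(maximalRealSubfield L)) L (IsCMField.complexConj L) 3 H) μ) (ξ : Ξ),
      Mem P ξ →
      ∀ (M : Type) [AddCommGroup M] [Module ℂ M] (σK : Representation ℂ (uFormGroup (Fin 2) (Fin 1)).maximalCompact M)
        (σ𝔤 : (uFormGroup (Fin 2) (Fin 1)).lie →ₗ⁅ℝ⁆ Module.End ℂ M) (hM : IsGKModule (uFormGroup (Fin 2) (Fin 1)) σK σ𝔤),
        IsIrreducibleGK σK σ𝔤 →
        (∃ T₁ : P.archModuleCM ι T hT →ₗ[ℂ] M,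
          (∀ (k : (uFormGroup (Fin 2) (Fin 1)).maximalCompact) (w : P.archModuleCM ι T hT),
              T₁ (P.archRepKCM ι T hT k w) = σK k (T₁ w)) ∧
            (∀ (X : (uFormGroup (Fin 2) (Fin 1)).lie) (w : P.archModuleCM ι T hT),
              T₁ (P.archRepLieCM ι T hT X w) = σ𝔤 X (T₁ w)) ∧ T₁ ≠ 0) →
        ∀ δ : ℤ, (δ = 1 ∨ δ = -1) → upqTypeClasses σK σ𝔤 hM.ad_compat 1 δ ≠ ⊥ → δ = sgn ξ)
    (hS3 : ∀ (W : Type) [AddCommGroup W] [Module ℂ W]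
      (σ : Representation ℂ (finAdelic (↥(maximalRealSubfield L)) L (IsCMField.complexConj L) 3 H) W),
      σ.IsIrreducible → σ.IsSmooth →
      ∀ (P P' : DiscreteAutomorphicRep (adelicGroupData (↥(maximalRealSubfield L)) L (IsCMField.complexConj L) 3 H) μ) (ξ ξ' : Ξ),
        P.HasFinComponent σ → P'.HasFinComponent σ → Mem P ξ → Mem P' ξ' → ξ = ξ') :
    ∀ (W : Type) [AddCommGroup W] [Module ℂ W]
      (σ : Representation ℂ (finAdelic (↥(maximalRealSubfield L)) L (IsCMField.complexConj L) 3 H) W),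
      σ.IsIrreducible → σ.IsSmooth →
    ∀ (P P' : DiscreteAutomorphicRep (adelicGroupData (↥(maximalRealSubfield L)) L (IsCMField.complexConj L) 3 H) μ),
      P.HasFinComponent σ → P'.HasFinComponent σ →
    ∀ (M : Type) [AddCommGroup M] [Module ℂ M] (σK : Representation ℂ (uFormGroup (Fin 2) (Fin 1)).maximalCompact M)
      (σ𝔤 : (uFormGroup (Fin 2) (Fin 1)).lie →ₗ⁅ℝ⁆ Module.End ℂ M) (hM : IsGKModule (uFormGroup (Fin 2) (Fin 1)) σK σ𝔤),
      IsIrreducibleGK σK σ𝔤 →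
      (∃ T₁ : P.archModuleCM ι T hT →ₗ[ℂ] M,
        (∀ (k : (uFormGroup (Fin 2) (Fin 1)).maximalCompact) (w : P.archModuleCM ι T hT),
            T₁ (P.archRepKCM ι T hT k w) = σK k (T₁ w)) ∧
          (∀ (X : (uFormGroup (Fin 2) (Fin 1)).lie) (w : P.archModuleCM ι T hT),
            T₁ (P.archRepLieCM ι T hT X w) = σ𝔤 X (T₁ w)) ∧ T₁ ≠ 0) →
    ∀ (M' : Type) [AddCommGroup M'] [Module ℂ M'] (σK' : Representation ℂ (uFormGroup (Fin 2) (Fin 1)).maximalCompact M')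
      (σ𝔤' : (uFormGroup (Fin 2) (Fin 1)).lie →ₗ⁅ℝ⁆ Module.End ℂ M') (hM' : IsGKModule (uFormGroup (Fin 2) (Fin 1)) σK' σ𝔤'),
      IsIrreducibleGK σK' σ𝔤' →
      (∃ T₂ : P'.archModuleCM ι T hT →ₗ[ℂ] M',
        (∀ (k : (uFormGroup (Fin 2) (Fin 1)).maximalCompact) (w : P'.archModuleCM ι T hT),
            T₂ (P'.archRepKCM ι T hT k w) = σK' k (T₂ w)) ∧
          (∀ (X : (uFormGroup (Fin 2) (Fin 1)).lie) (w : P'.archModuleCM ι T hT),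
            T₂ (P'.archRepLieCM ι T hT X w) = σ𝔤' X (T₂ w)) ∧ T₂ ≠ 0) →
      upqTypeClasses σK σ𝔤 hM.ad_compat 1 1 ≠ ⊥ → upqTypeClasses σK' σ𝔤' hM'.ad_compat 1 (-1) ≠ ⊥ → False := by
  intro W _ _ σ hirr hsm P P' hfin hfin' M _ _ σK σ𝔤 hM hirrM hT₁ M' _ _ σK' σ𝔤' hM' hirrM' hT₂ hne hne'
  -- S2♭: both `P` and `P′` lie in A-packets
  obtain ⟨ξ, hξ⟩ := hS2 P M σK σ𝔤 hM hirrM hT₁ 1 (Or.inl rfl) hne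
  obtain ⟨ξ', hξ'⟩ := hS2 P' M' σK' σ𝔤' hM' hirrM' hT₂ (-1) (Or.inr rfl) hne'
  -- D6-sign: the archimedean types are the packet signs
  have h₁ : (1 : ℤ) = sgn ξ := hSgn P ξ hξ M σK σ𝔤 hM hirrM hT₁ 1 (Or.inl rfl) hne
  have h₂ : (-1 : ℤ) = sgn ξ' := hSgn P' ξ' hξ' M' σK' σ𝔤' hM' hirrM' hT₂ (-1) (Or.inr rfl) hne'
  -- S3♭: the common finite component pins the packet
  have h₃ : ξ = ξ' := hS3 W σ hirr hsm P P' ξ ξ' hfin hfin' hξ hξ'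
  subst h₃
  omega

/-- **E1_coh ⇐ S2♭ + M♭ (pointwise fold).**  For ANY packet type `Ξ` and membership predicate `Mem`: if (hS2) every discrete `P` carrying the
cohomology token lies in some packet `ξ` [Rogawski1990 Thm. 13.3.6 (c), §15.3 ¶1] and (hMult) every member of a packet has multiplicity `≤ 1` in
`L²` [Thm. 14.6.4: `m ∈ {0, 1}` on `Π′(ξ)`], then the body of `StubE1coh` at this datum holds: a discrete `P` of holomorphic or antiholomorphic
cotangent type at `ι` carries the token (§1 `exists_cohToken_of_isHolOrAntihol_cpt`), hence lies in a packet, hence `m(P) ≤ 1`.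
[cite: Rogawski1990, Thm. 13.3.6 (c); §14.6 Thm. 14.6.4; §15.3 ¶1] [cite: BorelWallach2000, VI Thm. 4.11] -/
theorem e1coh_pointwise_of_SLayer
    (hdef : ∀ τ' : L →+* ℂ, InfinitePlace.mk τ' ≠ InfinitePlace.mk ι → (H.map τ').PosDef) (h2 : 2 ≤ Module.finrank ℚ ↥(maximalRealSubfield L))
    (hS2 : ∀ (P : DiscreteAutomorphicRep (adelicGroupData (↥(maximalRealSubfield L)) L (IsCMField.complexConj L) 3 H) μ)
      (M : Type) [AddCommGroup M] [Module ℂ M] (σK : Representation ℂ (uFormGroup (Fin 2) (Fin 1)).maximalCompact M)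
      (σ𝔤 : (uFormGroup (Fin 2) (Fin 1)).lie →ₗ⁅ℝ⁆ Module.End ℂ M) (hM : IsGKModule (uFormGroup (Fin 2) (Fin 1)) σK σ𝔤),
      IsIrreducibleGK σK σ𝔤 →
      (∃ T₁ : P.archModuleCM ι T hT →ₗ[ℂ] M,
        (∀ (k : (uFormGroup (Fin 2) (Fin 1)).maximalCompact) (w : P.archModuleCM ι T hT),
            T₁ (P.archRepKCM ι T hT k w) = σK k (T₁ w)) ∧
          (∀ (X : (uFormGroup (Fin 2) (Fin 1)).lie) (w : P.archModuleCM ι T hT),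
            T₁ (P.archRepLieCM ι T hT X w) = σ𝔤 X (T₁ w)) ∧ T₁ ≠ 0) →
      ∀ δ : ℤ, (δ = 1 ∨ δ = -1) → upqTypeClasses σK σ𝔤 hM.ad_compat 1 δ ≠ ⊥ → ∃ ξ : Ξ, Mem P ξ)
    (hMult : ∀ (P : DiscreteAutomorphicRep (adelicGroupData (↥(maximalRealSubfield L)) L (IsCMField.complexConj L) 3 H) μ) (ξ : Ξ),
      Mem P ξ →
      ((adelicGroupData (↥(maximalRealSubfield L)) L (IsCMField.complexConj L) 3 H).rightRegular μ).multiplicity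
          P.space.toContRep ≤ 1) :
    ∀ (P : DiscreteAutomorphicRep (adelicGroupData (↥(maximalRealSubfield L)) L (IsCMField.complexConj L) 3 H) μ),
      (P.IsHolCotangentAt (cmArchSection L ι H T hT) (cmCompactFactor L ι H T hT) ∨
        P.IsAntiholCotangentAt (cmArchSection L ι H T hT) (cmCompactFactor L ι H T hT)) →
      ((adelicGroupData (↥(maximalRealSubfield L)) L (IsCMField.complexConj L) 3 H).rightRegular μ).multiplicity
          P.space.toContRep ≤ 1 := by
  intro P hP
  have h := exists_cohToken_of_isHolOrAntihol_cpt L ι H T hT μ hdef h2 P hP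
  obtain ⟨M, _, _, σK, σ𝔤, hM, δ, hδ, hirrM, hT₁, hne⟩ := h
  obtain ⟨ξ, hξ⟩ := hS2 P M σK σ𝔤 hM hirrM hT₁ δ hδ hne
  exact hMult P ξ hξ

end Datum

end Summit.HodgeConjecture.HodgeConjecture.Cruxes.H413.F0P3SLayerFoldShapes

end
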